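import Literature.Computability.AlgebraicComplexity.AndrewsForbes2022Cor39Proofs
import Literature.Computability.AlgebraicComplexity.AndrewsForbes2022Lemma71Proofs

/-!
# Andrews–Forbes 2022, Theorem 7.3 — border-formula hardness of the determinant transfers to every
# bideterminant `(K_σ | K_σ)` (the reduction step of Thm. 7.3, EXPLICIT and PROVED)

R. Andrews, M. A. Forbes, *Ideals, determinants, and straightening: proving and using lower bounds
for polynomial ideals*, STOC 2022 = arXiv:2112.00792 [`AndrewsForbes2022`], §7, **Theorem 7.3**
(printed p. 52; statement `p0037:L53–L64`, proof `p0037:L66–L75` of `lit read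
paper:arxiv-2112.00792`): over a field of characteristic zero, a super-polynomial lower bound on the
border formula complexity of an ABP-computable family (equivalently, by VBP-completeness, of the
determinant) gives the hitting set generators of Prop. 7.2 for the closure of small formulas.  The
companion statement file `AndrewsForbes2022Applications.lean` (val-lit row AndrewsForbes2022-B)
records Thm. 7.3 as NOT typed (every parameter an unnamed `ω(1)` / `o(1)`); its mathematical
content is the REDUCTION in its proof (p0037:L70–L74):

> "Let `X` be an `n × m` generic matrix and let `σ` be a partition.  Let `Φ` be a formula of size
> `s` which computes `(K_σ | K_σ)(X) + O(ε)`.  By using Corollary 3.9 and converting the resulting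
> circuit into a formula, we obtain a formula of size `O(s n² m²) ≤ O(s³)` which computes
> `det_r(X) + O(ε)` for `r = Θ(σ₁^{1/3})`.  Such a formula must be of size `r^{ω(1)}`.  This
> implies `s ≥ r^{ω(1)}`, which in turn yields `s ≥ σ₁^{ω(1)}`.  Hence the hypothesis of
> Proposition 7.2 holds."

This file types and PROVES that reduction with explicit constants, in the gate-count measure of the
tree's `formulaClass` / `borderFormulaComplexity` (fan-in-two gates, weighted sums, free constants;
`AndrewsForbes2022Applications.lean`):

* `DepthThreeOracleComputes.mem_borderClass_formulaClass` — "converting the resulting circuit into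
  a formula": the depth-three single-`h`-oracle circuit `u · h(a(y), ε^{N+1}) + v` of Thm. 3.8
  (`DepthThreeOracleComputes`, affine forms `a_x` in the `|ι|` variables `y`), fed a formula `h`
  with `≤ s` gates, is a formula with `≤ (s+1)(2|ι| + 3) + 1` gates
  (`formulaComplexity_bind₁_le` of `FormulaUnfolding.lean`; an affine form costs `≤ 2|ι| + 2`
  gates, `formulaComplexity_le_of_totalDegree_le_one`).
* `AndrewsForbes2022_cor_3_9_borderFormula` — **Cor. 3.9 for border formula complexity**
  (char `0`): for nonzero `f ∈ I^det_{n,m,r}` and `2t³ ≤ r`,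
  `borderFormulaComplexity(det_t) ≤ (borderFormulaComplexity(f) + 1)(2t² + 3) + 1` (the tree's
  Cor. 3.9, `AndrewsForbes2022_cor_3_9_holds`, has the constant `2`: IL17's pruned Mahajan–Vinay
  ABP for `det_t` on `≤ 2t³` vertices, `Corollary39.layeredABPComputes_detPoly_cubic`, then
  Thm. 3.8 `AndrewsForbes2022_thm_3_8_holds`).  Print's "`O(s n² m²)`" is here `O(s t²)`: the
  bottom layer of the tree's Thm. 3.8 circuit consists of affine forms in the `t²` variables of
  `det_t`.
* `AndrewsForbes2022_thm_7_3_explicit` — **the transfer**: for every nonzero shape `σ` with parts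
  in `[1, min(n,m)]` and `2t³ ≤ σ₁`,
  `borderFormulaComplexity(det_t) ≤ (borderFormulaComplexity((K_σ|K_σ)) + 1)(2t² + 3) + 1`
  (`(K_σ | K_σ) ∈ I^det_{n,m,σ₁}` since its first factor is the leading `σ₁ × σ₁` minor,
  `kBideterminant_mem_detIdeal_sup`; it is nonzero, `kBideterminant_ne_zero`).
* `AndrewsForbes2022_thm_7_3_lemma71Hypothesis` — "Hence the hypothesis of Proposition 7.2 holds":
  from ANY lower bound `u(t) ≤ borderFormulaComplexity(det_t)` (all `t`), the explicit MONOTONE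
  function `T = Theorem73.transfer u` (`T(r) = min_{r' ≥ r} ((u(τ(r')) - 1) / (2τ(r')² + 3) - 1)`,
  `τ(r') = max {t : 2t³ ≤ r'}`) satisfies the hypothesis of Lemma 7.1 / Prop. 7.2 as typed in
  `AndrewsForbes2022_lemma_7_1`: `T` monotone and `T(σ₁) ≤ borderFormulaComplexity((K_σ | K_σ))`
  for every admissible `σ` in every `n' × m'`; whence (`AndrewsForbes2022_thm_7_3_generator`, with
  `AndrewsForbes2022_lemma_7_1_holds`) `𝒢_{ν,ν,r-1}` hits the closure of the `ν²`-variate size-`s`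
  formulas once `2(s+1)ν² < T(r)` — Thm. 7.3 for `k = 1` with the constants written out; the
  `k`-fold generator is `AndrewsForbes2022_prop_7_2_explicit` (`AndrewsForbes2022Prop72Proofs.lean`)
  fed with this `T`.

* `borderFormulaComplexity_le_of_layeredABPComputes` — the first sentence of the proof
  ("Because the determinant is VBP-complete, …"), explicit for the tree's layered ABPs and every
  field: `borderFormulaComplexity(g) ≤ (borderFormulaComplexity(det_m) + 1)(2|ι| + 3)` for `g`
  computed by a layered ABP on `m` vertices (Lemma 3.6, `AndrewsForbes2022_lemma_3_6_holds`:
  `g = det A(y) - 1` with affine `A`).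

What is NOT formalized: the asymptotic sentence itself (`n^{ω(1)}` ⇒ `σ₁^{ω(1)}`: if
`u(t) ≥ t^{ω(1)}` then `T(r) ≥ r^{ω(1)}`, elementary from the formula for `T` but prose in print)
and, as for Prop. 7.2, bullets (1)–(4) in `o(1)` form.  No named facts are introduced (D-0026):
definitions with bodies and proved theorems only.

Honest framing: kernel-checked transcription of a printed CONDITIONAL hardness-to-randomness
reduction (typed literature for the val-lit NP corpus, V4 companion of GAP row N7); VP ≠ VNP is
NOT proved and nothing here is progress on it.  (val-lit t24 g3, 2026-08-26.)

## References

* [AndrewsForbes2022] R. Andrews, M. A. Forbes, STOC 2022, doi:10.1145/3519935.3520025,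
  arXiv:2112.00792 — Thm. 7.3 (p. 52), Cor. 3.9 (p. 33), Thm. 3.8 (p. 31), Lemma 7.1 (p. 50).
* [BurgisserClausenShokrollahi1997] P. Bürgisser, M. Clausen, M. A. Shokrollahi, *Algebraic
  Complexity Theory*, Springer 1997, §21.1 (formula size calculus, via `FormulaUnfolding.lean`).
-/

noncomputable section

open MvPolynomial Matrix
open scoped RatFunc LaurentSeries Polynomial

namespace Literature.Computability.AlgebraicComplexity

universe u v w

/-! ## Formula-size bookkeeping: constants, affine forms -/

section FormulaSize

variable {k : Type u} [CommSemiring k] {σ : Type v}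

/-- A constant is a fan-in-two formula with no gates: `E(C c) = 0`. [cite: BurgisserClausenShokrollahi1997, (21.19)] -/
theorem formulaComplexity_C_eq_zero (c : k) : formulaComplexity (C c : MvPolynomial σ k) = 0 := by
  have h := (exists_wexpr_iff_formulaComplexity_le (C c : MvPolynomial σ k) 0).mp
    ⟨.const c, WExpr.eval_const c, le_rfl⟩
  omega

/-- An affine form in `#σ` variables has a fan-in-two formula with at most `2 #σ + 2` gates (the
tree's `ArithCircuit.exists_formula_of_totalDegree_le_one`, BCS (21.36) Stage 0).
[cite: BurgisserClausenShokrollahi1997, Thm. (21.36) (proof, (F) Stage 0), p. 567] -/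
theorem formulaComplexity_le_of_totalDegree_le_one [Fintype σ] {p : MvPolynomial σ k}
    (hp : p.totalDegree ≤ 1) : formulaComplexity p ≤ 2 * Fintype.card σ + 2 := by
  obtain ⟨P, -, hf, h2, he, hs⟩ := ArithCircuit.exists_formula_of_totalDegree_le_one hp
  exact (formulaComplexity_le_size hf h2 he).trans hs

end FormulaSize

/-! ## Border formula complexity: attainment, and the depth-three oracle circuit as a formula -/

section BorderFormula

variable {F : Type u} [Field F]

/-- Exact computation bounds border computation: `borderFormulaComplexity f ≤ E(f)` (the formula for
`f`, constants pushed into `F((ε))`, computes `f + O(ε)` with error `0`). [cite: AndrewsForbes2022, Def. 2.1 and §2.1] -/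
theorem borderFormulaComplexity_le_formulaComplexity {M : Type v} (f : MvPolynomial M F) :
    borderFormulaComplexity F f ≤ formulaComplexity f := by
  refine Nat.sInf_le (mem_borderClass_of_mem ?_)
  change formulaComplexity _ ≤ _
  exact formulaComplexity_map_le _ _

/-- Membership in the closure of the size-`s` formulas bounds the border formula complexity by `s`.
[cite: AndrewsForbes2022, §2.1 (border complexity for formulas)] -/
theorem borderFormulaComplexity_le_of_mem {M : Type v} {f : MvPolynomial M F} {s : ℕ}
    (h : f ∈ borderClass F (formulaClass (LaurentSeries F) M s)) :
    borderFormulaComplexity F f ≤ s :=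
  Nat.sInf_le h

/-- The border formula complexity is attained: `f` lies in the closure of the formulas with
`≤ borderFormulaComplexity f` gates. [cite: AndrewsForbes2022, §2.1 (border complexity for formulas)] -/
theorem mem_borderClass_formulaClass_borderFormulaComplexity {M : Type v} (f : MvPolynomial M F) :
    f ∈ borderClass F (formulaClass (LaurentSeries F) M (borderFormulaComplexity F f)) :=
  Nat.sInf_mem (s := {s | f ∈ borderClass F (formulaClass (LaurentSeries F) M s)})
    ⟨formulaComplexity f, mem_borderClass_of_mem (formulaComplexity_map_le _ _)⟩

/-- **"Converting the resulting circuit into a formula"** (proof of Thm. 7.3, p0037:L72): if the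
depth-three `h`-oracle circuit of Thm. 3.8 — `u · h(a(y), ε^{N+1}) + v` with affine forms `a_x(y)`
in the `|ι|` variables `y` (`DepthThreeOracleComputes h g`) — computes `g(y) + O(ε)`, and `h` is a
fan-in-two formula with `≤ s` gates over `F((ε))`, then `g` lies in the closure of the `ι`-variate
formulas with `≤ (s+1)(2|ι| + 3) + 1` gates: substitute the affine forms (`≤ 2|ι| + 2` gates each)
into the `≤ s + 1` leaves of `h(·, ε^{N+1})` (a change of constants, `formulaComplexity_map_le`;
`formulaComplexity_bind₁_le`), scale by `u` and add `v` (two more gates).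
[cite: AndrewsForbes2022, Thm. 7.3 (proof) with Thm. 3.8 (first bullet)] -/
theorem DepthThreeOracleComputes.mem_borderClass_formulaClass {σ : Type v} {ι : Type w} [Fintype ι]
    {h : MvPolynomial σ (LaurentSeries F)} {g : MvPolynomial ι F} {s : ℕ}
    (hcomp : DepthThreeOracleComputes h (MvPolynomial.map (algebraMap F (LaurentSeries F)) g))
    (hs : formulaComplexity h ≤ s) :
    g ∈ borderClass F (formulaClass (LaurentSeries F) ι ((s + 1) * (2 * Fintype.card ι + 3) + 1)) := by
  obtain ⟨N, a, u, v, ha, hord⟩ := hcomp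
  refine ⟨_, ?_, hord⟩
  change formulaComplexity _ ≤ _
  -- the inner substitution `h(a(y), ε^{N+1})`
  have h1 : formulaComplexity (MvPolynomial.map (epsPow F N) h) ≤ s :=
    (formulaComplexity_map_le _ _).trans hs
  have h2 : ∀ x, formulaComplexity
      (MvPolynomial.map (algebraMap (RatFunc F) (LaurentSeries F)) (a x)) ≤ 2 * Fintype.card ι + 2 :=
    fun x => (formulaComplexity_map_le _ _).trans (formulaComplexity_le_of_totalDegree_le_one (ha x))
  have h3 : formulaComplexity (MvPolynomial.aeval
      (fun x => MvPolynomial.map (algebraMap (RatFunc F) (LaurentSeries F)) (a x))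
      (MvPolynomial.map (epsPow F N) h)) ≤ s + (s + 1) * (2 * Fintype.card ι + 2) := by
    rw [aeval_eq_bind₁]
    exact (formulaComplexity_bind₁_le h2 _).trans
      (Nat.add_le_add h1 (Nat.mul_le_mul_right _ (Nat.succ_le_succ h1)))
  -- scaling by `u` and adding `v`
  have h4 := formulaComplexity_smul_le (algebraMap (RatFunc F) (LaurentSeries F) u)
    (MvPolynomial.aeval (fun x => MvPolynomial.map (algebraMap (RatFunc F) (LaurentSeries F)) (a x))
      (MvPolynomial.map (epsPow F N) h))
  rw [smul_eq_C_mul] at h4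
  have h5 := formulaComplexity_add_le
    (C (algebraMap (RatFunc F) (LaurentSeries F) u) *
      MvPolynomial.aeval (fun x => MvPolynomial.map (algebraMap (RatFunc F) (LaurentSeries F)) (a x))
        (MvPolynomial.map (epsPow F N) h))
    (C (algebraMap (RatFunc F) (LaurentSeries F) v) : MvPolynomial ι (LaurentSeries F))
  rw [formulaComplexity_C_eq_zero] at h5
  refine h5.trans ?_
  nlinarith [h3, h4]

end BorderFormula

/-! ## Corollary 3.9 for border formula complexity (characteristic zero) -/

section Cor39

/-- **Andrews–Forbes 2022, Cor. 3.9 read for border FORMULA complexity** (the use made of it in the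
proof of Thm. 7.3, p0037:L72; char `0`): for a nonzero `f ∈ I^det_{n,m,r}` and `t` with `2t³ ≤ r`,
`borderFormulaComplexity(det_t) ≤ (borderFormulaComplexity(f) + 1) · (2t² + 3) + 1`.
Proof: Thm. 3.8 (`AndrewsForbes2022_thm_3_8_holds`) applied to an optimal border formula `h` for
`f` and IL17's pruned Mahajan–Vinay layered ABP for `det_t` on `≤ 2t³` vertices
(`Corollary39.layeredABPComputes_detPoly_cubic`, the constant `2` of
`AndrewsForbes2022_cor_3_9_holds`), then `DepthThreeOracleComputes.mem_borderClass_formulaClass`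
with `|ι| = t²`; `t = 0` (`det_0 = 1`) is free. [cite: AndrewsForbes2022, Cor. 3.9 with Thm. 7.3 (proof)] -/
theorem AndrewsForbes2022_cor_3_9_borderFormula (F : Type) [Field F] [CharZero F] (n m r : ℕ)
    (f : MvPolynomial (Fin n × Fin m) F) (hf : f ∈ detIdeal F n m r) (hf0 : f ≠ 0) (t : ℕ)
    (ht : 2 * t ^ 3 ≤ r) :
    borderFormulaComplexity F (detPoly (Fin t) F) ≤
      (borderFormulaComplexity F f + 1) * (2 * (t * t) + 3) + 1 := by
  rcases Nat.eq_zero_or_pos t with rfl | htpos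
  · -- `det_0 = 1` is a formula with no gates
    have h1 : detPoly (Fin 0) F = C 1 := by simp [detPoly]
    rw [h1]
    exact (borderFormulaComplexity_le_formulaComplexity _).trans
      (by rw [formulaComplexity_C_eq_zero]; exact Nat.zero_le _)
  · obtain ⟨h, hh, hhf⟩ := mem_borderClass_formulaClass_borderFormulaComplexity (F := F) f
    have hcomp := AndrewsForbes2022_thm_3_8_holds F n m r f hf hf0 h hhf _ _
      (InLayeredABPBorder.of_computes
        ((Corollary39.layeredABPComputes_detPoly_cubic (k := F) t htpos).mono ht))
    refine (borderFormulaComplexity_le_of_mem (hcomp.mem_borderClass_formulaClass hh)).trans ?_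
    simp [Fintype.card_prod, Fintype.card_fin]

end Cor39

/-! ## `(K_σ | K_σ)` lies in `I^det_{n,m,σ₁}` and is nonzero -/

section Bideterminant

variable {F : Type u} [Field F] {n m : ℕ}

/-- The leading `s × s` minor is one of the generators of `I^det_{n,m,s}`. [cite: AndrewsForbes2022, §2 (Preliminaries) and Def. 2.23] -/
theorem leadingMinor_mem_detIdeal {s : ℕ} (hn : s ≤ n) (hm : s ≤ m) :
    leadingMinor F n m s ∈ detIdeal F n m s := by
  rw [leadingMinor_of_le hn hm]
  exact Ideal.subset_span ⟨Fin.castLE hn, Fin.castLE hm, rfl⟩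

/-- The largest part `σ₁ = σ.sup` of a nonzero shape is one of its parts (shapes are multisets of
parts in the tree's `kBideterminant`). [cite: AndrewsForbes2022, Def. 2.21 (partitions, `σ₁`)] -/
theorem Theorem73.sup_mem_of_ne_zero {σ : Multiset ℕ} (hσ : σ ≠ 0) : σ.sup ∈ σ := by
  classical
  obtain ⟨a, ha, h⟩ := Finset.exists_mem_eq_sup σ.toFinset (Multiset.toFinset_nonempty.mpr hσ) id
  have h' : σ.toFinset.sup id = σ.sup := by
    rw [Finset.sup_def, Multiset.map_id, Multiset.toFinset_val, Multiset.sup_dedup]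
  rw [← h', h]
  exact Multiset.mem_toFinset.mp ha

/-- **`(K_σ | K_σ) ∈ I^det_{n,m,σ₁}`** (its factor for the first row of `K_σ` is the leading
`σ₁ × σ₁` minor; how Cor. 3.9 is applied to `(K_σ | K_σ)` in the proof of Thm. 7.3, p0037:L72).
[cite: AndrewsForbes2022, Thm. 7.3 (proof)] -/
theorem kBideterminant_mem_detIdeal_sup {σ : Multiset ℕ} (hσ0 : σ ≠ 0)
    (hσ : ∀ p ∈ σ, 0 < p ∧ p ≤ min n m) :
    kBideterminant F n m σ ∈ detIdeal F n m σ.sup := by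
  have hmem := Theorem73.sup_mem_of_ne_zero hσ0
  obtain ⟨-, hle⟩ := hσ _ hmem
  have hsplit : kBideterminant F n m (σ.sup ::ₘ σ.erase σ.sup) = kBideterminant F n m σ := by
    rw [Multiset.cons_erase hmem]
  rw [← hsplit, kBideterminant_cons]
  exact Ideal.mul_mem_right _ _
    (leadingMinor_mem_detIdeal (le_min_iff.mp hle).1 (le_min_iff.mp hle).2)

/-- A leading principal minor `det X_{[s],[s]}` of the generic matrix is a nonzero polynomial (it
evaluates to `1` at the test matrix `diag(1, …, 1, 0, …)`). [cite: AndrewsForbes2022, §3.1 (bideterminants `(K_σ | K_σ)`)] -/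
theorem leadingMinor_ne_zero {s : ℕ} (hn : s ≤ n) (hm : s ≤ m) : leadingMinor F n m s ≠ 0 := by
  intro h0
  have h1 := AndrewsForbes.ev_leadingMinor (F := F) hn hm (AndrewsForbes.rectOne F n m s)
  rw [AndrewsForbes.det_corner_rectOne, if_pos le_rfl, h0, map_zero] at h1
  exact zero_ne_one h1

/-- **`(K_σ | K_σ) ≠ 0`** for a shape with parts in `[1, min(n,m)]` (a product of nonzero minors in
the domain `F[X]`). [cite: AndrewsForbes2022, §3.1 (bideterminants `(K_σ | K_σ)`)] -/
theorem kBideterminant_ne_zero {σ : Multiset ℕ} (hσ : ∀ p ∈ σ, 0 < p ∧ p ≤ min n m) :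
    kBideterminant F n m σ ≠ 0 := by
  unfold kBideterminant
  refine Multiset.prod_ne_zero fun h0 => ?_
  obtain ⟨p, hp, hp0⟩ := Multiset.mem_map.mp h0
  obtain ⟨-, hle⟩ := hσ p hp
  exact leadingMinor_ne_zero (le_min_iff.mp hle).1 (le_min_iff.mp hle).2 hp0

end Bideterminant

/-! ## Theorem 7.3: the transfer, and the hypothesis of Lemma 7.1 / Prop. 7.2 -/

section Thm73

/-- **Andrews–Forbes 2022, Theorem 7.3 — the reduction, explicit and PROVED** (char `0`;
p0037:L70–L74): for every shape `σ ≠ ∅` with parts in `[1, min(n,m)]` and every `t` with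
`2t³ ≤ σ₁`, `borderFormulaComplexity(det_t) ≤ (borderFormulaComplexity((K_σ | K_σ)) + 1)(2t² + 3) + 1`
— print: "a formula of size `s` which computes `(K_σ | K_σ)(X) + O(ε)` … [gives] a formula of size
`O(s n² m²)` which computes `det_r(X) + O(ε)` for `r = Θ(σ₁^{1/3})`" (here `O(s t²)`, see the
module docstring).  Contrapositively: border-formula lower bounds for `det_t` are border-formula
lower bounds for every `(K_σ | K_σ)` with `σ₁ ≥ 2t³`. [cite: AndrewsForbes2022, Thm. 7.3 (proof)] -/
theorem AndrewsForbes2022_thm_7_3_explicit (F : Type) [Field F] [CharZero F] (n m : ℕ)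
    (σ : Multiset ℕ) (hσ0 : σ ≠ 0) (hσ : ∀ p ∈ σ, 0 < p ∧ p ≤ min n m) (t : ℕ)
    (ht : 2 * t ^ 3 ≤ σ.sup) :
    borderFormulaComplexity F (detPoly (Fin t) F) ≤
      (borderFormulaComplexity F (kBideterminant F n m σ) + 1) * (2 * (t * t) + 3) + 1 :=
  AndrewsForbes2022_cor_3_9_borderFormula F n m σ.sup _ (kBideterminant_mem_detIdeal_sup hσ0 hσ)
    (kBideterminant_ne_zero hσ) t ht

namespace Theorem73

/-- `τ(r) = max {t : 2t³ ≤ r}`, the size of the determinant reached from rank `r` through Cor. 3.9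
(print: `r = Θ(σ₁^{1/3})`, p0037:L72). [cite: AndrewsForbes2022, Thm. 7.3 (proof)] -/
def detSize (r : ℕ) : ℕ := Nat.findGreatest (fun t => 2 * t ^ 3 ≤ r) r

/-- `2 τ(r)³ ≤ r`. [cite: AndrewsForbes2022, Thm. 7.3 (proof)] -/
theorem two_mul_detSize_pow_le (r : ℕ) : 2 * detSize r ^ 3 ≤ r :=
  Nat.findGreatest_spec (P := fun t => 2 * t ^ 3 ≤ r) (Nat.zero_le r) (by simp)

/-- Maximality of `τ(r)`: every `t` with `2t³ ≤ r` is `≤ τ(r)`. [cite: AndrewsForbes2022, Thm. 7.3 (proof)] -/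
theorem le_detSize {r t : ℕ} (h : 2 * t ^ 3 ≤ r) : t ≤ detSize r := by
  refine Nat.le_findGreatest ?_ h
  calc t ≤ t ^ 3 := Nat.le_self_pow (by norm_num) t
    _ ≤ 2 * t ^ 3 := Nat.le_mul_of_pos_left _ (by norm_num)
    _ ≤ r := h

/-- `τ` is monotone. [cite: AndrewsForbes2022, Thm. 7.3 (proof)] -/
theorem detSize_mono : Monotone detSize :=
  fun _ _ h => le_detSize ((two_mul_detSize_pow_le _).trans h)

/-- The raw transferred bound `g_u(r) = (u(τ(r)) - 1) / (2τ(r)² + 3) - 1` obtained by solving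
`u(τ) ≤ (K + 1)(2τ² + 3) + 1` for `K` (natural-number division and subtraction).
[cite: AndrewsForbes2022, Thm. 7.3 (proof)] -/
def rawTransfer (u : ℕ → ℕ) (r : ℕ) : ℕ :=
  (u (detSize r) - 1) / (2 * (detSize r * detSize r) + 3) - 1

/-- The **monotone minorant** `r ↦ min_{r' ≥ r} g(r')` of a function `g : ℕ → ℕ` (Lemma 7.1 /
Prop. 7.2 ask for a monotone lower-bound function `t`; this realises "the hypothesis of
Proposition 7.2 holds", p0037:L75, from a pointwise bound). [cite: AndrewsForbes2022, Thm. 7.3 (proof)] -/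
def monotoneMinorant (g : ℕ → ℕ) (r : ℕ) : ℕ := sInf (g '' Set.Ici r)

/-- The monotone minorant is below `g`. [cite: AndrewsForbes2022, Thm. 7.3 (proof)] -/
theorem monotoneMinorant_le (g : ℕ → ℕ) (r : ℕ) : monotoneMinorant g r ≤ g r :=
  Nat.sInf_le ⟨r, Set.self_mem_Ici, rfl⟩

/-- The monotone minorant is monotone. [cite: AndrewsForbes2022, Thm. 7.3 (proof)] -/
theorem monotoneMinorant_mono (g : ℕ → ℕ) : Monotone (monotoneMinorant g) := by
  intro r r' h
  have hne : (g '' Set.Ici r').Nonempty := ⟨g r', r', Set.self_mem_Ici, rfl⟩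
  obtain ⟨x, hx, hgx⟩ := Nat.sInf_mem hne
  unfold monotoneMinorant
  rw [← hgx]
  exact Nat.sInf_le ⟨x, Set.mem_Ici.mpr (h.trans (Set.mem_Ici.mp hx)), rfl⟩

/-- A bound valid for all `r' ≥ r` is below the monotone minorant at `r` (how a lower bound
`B ≤ g_u(r')`, `r' ≥ r`, e.g. print's `σ₁^{ω(1)}`, passes to `T_u(r)`). [cite: AndrewsForbes2022, Thm. 7.3 (proof)] -/
theorem le_monotoneMinorant {g : ℕ → ℕ} {r B : ℕ} (h : ∀ r', r ≤ r' → B ≤ g r') :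
    B ≤ monotoneMinorant g r := by
  have hne : (g '' Set.Ici r).Nonempty := ⟨g r, r, Set.self_mem_Ici, rfl⟩
  obtain ⟨x, hx, hgx⟩ := Nat.sInf_mem hne
  unfold monotoneMinorant
  rw [← hgx]
  exact h x (Set.mem_Ici.mp hx)

/-- **The transferred lower-bound function** `T_u = min_{r' ≥ r} g_u(r')` (monotone minorant of
`rawTransfer u`): from a lower bound `u` on the border formula complexity of the determinants to a
monotone lower bound, in terms of `σ₁`, on that of the bideterminants `(K_σ | K_σ)`.
[cite: AndrewsForbes2022, Thm. 7.3 (proof)] -/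
def transfer (u : ℕ → ℕ) : ℕ → ℕ := monotoneMinorant (rawTransfer u)

/-- `T_u` is monotone. [cite: AndrewsForbes2022, Thm. 7.3 (proof)] -/
theorem transfer_mono (u : ℕ → ℕ) : Monotone (transfer u) := monotoneMinorant_mono _

end Theorem73

open Theorem73 in
/-- **"Hence the hypothesis of Proposition 7.2 holds"** (p0037:L75), explicit and PROVED (char `0`):
if `u(t) ≤ borderFormulaComplexity(det_t)` for every `t`, then the monotone function
`T_u = Theorem73.transfer u` satisfies the hypothesis of Lemma 7.1 / Prop. 7.2 exactly as typed in
`AndrewsForbes2022_lemma_7_1`: for every `n' × m'` and every shape `σ ≠ ∅` with parts in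
`[1, min(n',m')]`, `T_u(σ₁) ≤ borderFormulaComplexity((K_σ | K_σ))`.  (If `u(t) ≥ t^{ω(1)}` then
`T_u(r) ≥ r^{ω(1)}` — `τ(r) = Θ(r^{1/3})` — which is print's "`s ≥ σ₁^{ω(1)}`"; that asymptotic
sentence is not formalized.) [cite: AndrewsForbes2022, Thm. 7.3 (proof)] -/
theorem AndrewsForbes2022_thm_7_3_lemma71Hypothesis (F : Type) [Field F] [CharZero F] (u : ℕ → ℕ)
    (hu : ∀ t, u t ≤ borderFormulaComplexity F (detPoly (Fin t) F)) :
    Monotone (transfer u) ∧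
      ∀ (n' m' : ℕ) (σ : Multiset ℕ), σ ≠ 0 → (∀ p ∈ σ, 0 < p ∧ p ≤ min n' m') →
        transfer u σ.sup ≤ borderFormulaComplexity F (kBideterminant F n' m' σ) := by
  refine ⟨transfer_mono u, fun n' m' σ hσ0 hσ => ?_⟩
  refine (monotoneMinorant_le _ _).trans ?_
  -- `u(τ) ≤ bfc(det_τ) ≤ (K + 1)(2τ² + 3) + 1` with `K = bfc((K_σ|K_σ))`, `τ = τ(σ₁)`
  have h := (hu (detSize σ.sup)).trans
    (AndrewsForbes2022_thm_7_3_explicit F n' m' σ hσ0 hσ (detSize σ.sup)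
      (two_mul_detSize_pow_le _))
  unfold rawTransfer
  have h1 : (u (detSize σ.sup) - 1) / (2 * (detSize σ.sup * detSize σ.sup) + 3) ≤
      borderFormulaComplexity F (kBideterminant F n' m' σ) + 1 :=
    Nat.div_le_of_le_mul (by rw [mul_comm]; omega)
  omega

open Theorem73 in
/-- **Andrews–Forbes 2022, Theorem 7.3 for `k = 1`, explicit and PROVED** (char `0`): if
`u(t) ≤ borderFormulaComplexity(det_t)` for all `t`, then for `1 ≤ r` and
`2(s+1)ν² < T_u(r)` (`T_u = Theorem73.transfer u`, monotone) the matrix generator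
`𝒢_{ν,ν,r-1}(Y, Z) = YZ` (Construction 2.8) is a hitting set generator for the closure of the
`ν²`-variate fan-in-two formulas with `≤ s` gates over `F((ε))` — Lemma 7.1
(`AndrewsForbes2022_lemma_7_1_holds`) under the transferred hypothesis
(`AndrewsForbes2022_thm_7_3_lemma71Hypothesis`).  The `k`-fold generators of the printed
conclusion are `AndrewsForbes2022_prop_7_2_explicit` (`AndrewsForbes2022Prop72Proofs.lean`) with
`t = T_u`. [cite: AndrewsForbes2022, Thm. 7.3] -/
theorem AndrewsForbes2022_thm_7_3_generator (F : Type) [Field F] [CharZero F] (u : ℕ → ℕ)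
    (hu : ∀ t, u t ≤ borderFormulaComplexity F (detPoly (Fin t) F)) (ν s r : ℕ) (hr : 1 ≤ r)
    (h : 2 * (s + 1) * (ν * ν) < transfer u r) :
    IsHittingSetGenFor F (borderClass F (formulaClass (LaurentSeries F) (Fin ν × Fin ν) s))
      (matrixGenerator F ν ν (r - 1)) :=
  have H := AndrewsForbes2022_thm_7_3_lemma71Hypothesis F u hu
  AndrewsForbes2022_lemma_7_1_holds F (transfer u) H.1 H.2 ν s r hr h

end Thm73

/-! ## "Because the determinant is VBP-complete" (first sentence of the proof of Thm. 7.3) -/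

section VBPComplete

/-- **"Because the determinant is VBP-complete, the assumed lower bound on the border formula
complexity of `f_n` implies that [of] `det_n(X)`"** (proof of Thm. 7.3, first sentence, p0037:L67),
explicit and PROVED for the tree's layered ABPs, every field: if `g(y)` in `|ι|` variables is
computed by a layered ABP on `m` vertices then, by Lemma 3.6 ([Valiant 1979];
`AndrewsForbes2022_lemma_3_6_holds`: `g = det A(y) - 1` for an `m × m` matrix `A` of affine
forms), substituting `A(y)` into an optimal border formula for `det_m` gives
`borderFormulaComplexity(g) ≤ (borderFormulaComplexity(det_m) + 1)(2|ι| + 3)`; contrapositively a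
border-formula lower bound for an ABP-computable `g` is one for `det_m`, which
`AndrewsForbes2022_thm_7_3_lemma71Hypothesis` then transfers to the bideterminants.
[cite: AndrewsForbes2022, Thm. 7.3 (proof, first sentence) with Lemma 3.6] -/
theorem borderFormulaComplexity_le_of_layeredABPComputes (F : Type) [Field F] {ι : Type}
    [Fintype ι] (m : ℕ) (g : MvPolynomial ι F) (hg : LayeredABPComputes m g) :
    borderFormulaComplexity F g ≤
      (borderFormulaComplexity F (detPoly (Fin m) F) + 1) * (2 * Fintype.card ι + 3) := by
  obtain ⟨A, hA1, hAdet, -⟩ := AndrewsForbes2022_lemma_3_6_holds F ι m g hg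
  obtain ⟨h, hh, hhf⟩ :=
    mem_borderClass_formulaClass_borderFormulaComplexity (F := F) (detPoly (Fin m) F)
  change formulaComplexity h ≤ _ at hh
  -- the substitution `y ↦ A(y)` (entries pushed to `F((ε))`)
  obtain ⟨θ, hθ⟩ : ∃ θ : Fin m × Fin m → MvPolynomial ι (LaurentSeries F),
      θ = fun ij => MvPolynomial.map (algebraMap F (LaurentSeries F)) (A ij.1 ij.2) := ⟨_, rfl⟩
  have hdet : bind₁ θ (MvPolynomial.map (algebraMap F (LaurentSeries F)) (detPoly (Fin m) F)) =
      MvPolynomial.map (algebraMap F (LaurentSeries F)) (1 + g) := by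
    have h1 : bind₁ (fun ij : Fin m × Fin m => A ij.1 ij.2) (detPoly (Fin m) F) = A.det := by
      rw [detPoly, AlgHom.map_det]
      congr 1
      ext i j
      simp [mvPolynomialX, AlgHom.mapMatrix_apply]
    rw [hθ, ← map_bind₁, h1, hAdet]
  refine borderFormulaComplexity_le_of_mem ⟨bind₁ θ h + C (-1), ?_, ?_⟩
  · -- size: substitute the `≤ 2|ι| + 2`-gate affine forms into the `≤ s + 1` leaves, one more gate
    change formulaComplexity _ ≤ _
    have hθE : ∀ ij, formulaComplexity (θ ij) ≤ 2 * Fintype.card ι + 2 := fun ij => by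
      rw [hθ]
      exact (formulaComplexity_map_le _ _).trans
        (formulaComplexity_le_of_totalDegree_le_one (hA1 ij.1 ij.2))
    have h1 := formulaComplexity_bind₁_le hθE h
    have h2 := formulaComplexity_add_le (bind₁ θ h) (C (-1) : MvPolynomial ι (LaurentSeries F))
    rw [formulaComplexity_C_eq_zero] at h2
    refine h2.trans ?_
    have h3 : formulaComplexity (bind₁ θ h) ≤ borderFormulaComplexity F (detPoly (Fin m) F) +
        (borderFormulaComplexity F (detPoly (Fin m) F) + 1) * (2 * Fintype.card ι + 2) :=
      h1.trans (Nat.add_le_add hh (Nat.mul_le_mul_right _ (Nat.succ_le_succ hh)))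
    nlinarith [h3]
  · -- error term: `h(A) - 1 - g = (h - det_m)(A)` is `O(ε)` (the `A_{ij}` are `ε`-free)
    have herr : bind₁ θ h + C (-1) - MvPolynomial.map (algebraMap F (LaurentSeries F)) g =
        bind₁ θ (h - MvPolynomial.map (algebraMap F (LaurentSeries F)) (detPoly (Fin m) F)) := by
      rw [map_sub, hdet, map_add, map_one, C_neg, C_1]
      ring
    rw [herr]
    refine hhf.bind₁ fun ij => ?_
    rw [hθ]
    exact PolyOrdGE.map_algebraMap _

end VBPComplete

end Literature.Computability.AlgebraicComplexity
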